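import Literature.MathematicalPhysics.QuantumLattice.GrassmannRelabelling
import HarnessLib

/-!
# Charge scalings of the generators of a finite Grassmann algebra (`U(1)` covariance of `Δ_C`, `μ_C ⋆`, `effAction`)

Topic `MathematicalPhysics/QuantumLattice`; companion of `GrassmannRelabelling.lean` (equivariance of
Salmhofer's operator calculus `Δ_C`, `μ_C ⋆ = e^{Δ_C}`, the Wilsonian effective action `effAction R C V` and the
plain-sum kernels `kernel R F m` under a RELABELLING of the generators).  Here the generators are RESCALED:
for a weight `c : Γ → R` the substitution `v ↦ c · v` of the generator space (`LinearMap.mulLeft R c`) induces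
the algebra homomorphism `S_c := ExteriorAlgebra.map (LinearMap.mulLeft R c)`, `ψ(X) ↦ c(X) ψ(X)`
(`map_mulLeft_gen`).  The global `U(1)` charge rotation `ψ^± ↦ e^{±iα} ψ^±` of a fermionic theory
(Benfatto–Giuliani–Mastropietro 2006, §2.1, symmetry (2)) is the case `c(ψ⁺) = z`, `c(ψ⁻) = z⁻¹`.  This file
proves that every construction of the three files above is COVARIANT under charge scalings, with the
covariance RESCALED ENTRYWISE, `C ↦ ((X, Y) ↦ c(X) c(Y) C(X, Y))`:

* `grassmannDeriv_map_mulLeft` — `∂_Y (S_c a) = c(Y) · S_c (∂_Y a)`;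
* `iterDeriv_map_mulLeft`, **`kernel_map_mulLeft`** — `kernel (S_c F) m X = (∏ᵢ c(Xᵢ)) · kernel F m X`;
* `grassmannLaplacian_map_mulLeft`, `gaussConv_map_mulLeft` — `Δ_C (S_c a) = S_c (Δ_{c ⊗ c · C} a)` and the same
  for `μ_C ⋆ = e^{Δ_C}` (any `c`);
* for a scaling by UNITS (`d * c = 1`): `map_mulLeft_injective`, `map_mulLeft_grassmannExp`,
  `map_mulLeft_grassmannLog1p`, `effBoltzmann_map_mulLeft`, `effPartitionFn_map_mulLeft`,
  **`effAction_map_mulLeft`** — `effAction C (S_c V) = S_c (effAction (c ⊗ c · C) V)`;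
* the symmetry corollaries: if `c(X) c(Y) C(X, Y) = C(X, Y)` for all `X, Y` (the covariance pairs only labels
  of reciprocal weights — "charge conservation of the propagator") and `S_c V = V`, then
  `S_c (effAction C V) = effAction C V` (`map_mulLeft_effAction_of_invariant`), the normalised partition function
  is unchanged, and the kernels of any `S_c`-invariant `F` satisfy `(∏ᵢ c(Xᵢ)) · kernel F m X = kernel F m X`
  (`prod_mul_kernel_of_invariant`), hence VANISH on label strings of total weight `≠ 1`
  (`kernel_eq_zero_of_invariant`: the `U(1)` selection rule for effective actions — with `c(ψ^±) = 2^{±1}` a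
  kernel with unequal numbers of `ψ⁺` and `ψ⁻` legs is zero).

`GrassmannGaussianChargeRule.lean` proves the selection rule for the Berezin-integral layer (`gaussOn`); this file
is its counterpart for Salmhofer's `Δ_C` layer, on which `HubbardEffectiveAction(CT).lean` is built.

## Sources

G. Benfatto, A. Giuliani, V. Mastropietro, Ann. Henri Poincaré 7 (2006) 809, §2.1 (symmetry (2), global `U(1)`;
arXiv p. 6 of the held copy) [`BenfattoGiulianiMastropietro2006`]; M. Salmhofer, *Renormalization* (1999), §4.3
(4.86)–(4.88) [`Salmhofer1999`]; F. A. Berezin, *The Method of Second Quantization* (1966), Ch. I §3 (automorphisms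
of the Grassmann algebra induced by linear maps of the generators) [`Berezin1966`].  All statements here are
routine consequences ("folklore").

## Design

No new definitions: the scaling is written out as `ExteriorAlgebra.map (LinearMap.mulLeft R c)` and the rescaled
covariance as `Matrix.of fun X Y => c X * c Y * C X Y` in every statement.  `R` is any commutative ring
(`[Algebra ℚ R]` where `exp`, `log`, `Δ_C` or kernels occur); invertibility of the weight is asked as a second
weight `d` with `d * c = 1` only where it is needed (exponential, logarithm, effective action).
-/

noncomputable section

namespace Literature.MathematicalPhysics.QuantumLattice

open GrassmannAlgebra

section ChargeScaling

variable (R : Type*) [CommRing R] {Γ : Type*}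

/-- The substitution `v ↦ c · v` maps the basis vector of `X` to its `c(X)`-multiple. [folklore] -/
theorem mulLeft_single [DecidableEq Γ] (c : Γ → R) (X : Γ) (r : R) :
    LinearMap.mulLeft R c (Pi.single X r) = Pi.single X (c X * r) := by
  funext Y
  simp only [LinearMap.mulLeft_apply, Pi.mul_apply]
  by_cases h : Y = X
  · subst h; simp
  · simp [Pi.single_eq_of_ne h]

/-- **Charge scalings act on generators by `ψ(X) ↦ c(X) ψ(X)`.** [folklore] -/
theorem map_mulLeft_gen [DecidableEq Γ] (c : Γ → R) (X : Γ) :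
    ExteriorAlgebra.map (LinearMap.mulLeft R c) (gen R X) = c X • gen R X := by
  simp only [gen, ExteriorAlgebra.map_apply_ι, mulLeft_single, ← map_smul]
  congr 1
  funext Y
  by_cases h : Y = X
  · subst h; simp
  · simp [Pi.single_eq_of_ne h]

/-- Scaling by `d` after scaling by `c` is scaling by `d * c`. [folklore] -/
theorem map_mulLeft_map_mulLeft (c d : Γ → R) (a : GrassmannAlgebra R Γ) :
    ExteriorAlgebra.map (LinearMap.mulLeft R d) (ExteriorAlgebra.map (LinearMap.mulLeft R c) a) =
      ExteriorAlgebra.map (LinearMap.mulLeft R (d * c)) a := by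
  rw [← AlgHom.comp_apply, ExteriorAlgebra.map_comp_map]
  congr 2
  exact LinearMap.ext fun v => (mul_assoc d c v).symm

/-- Scaling by the unit weight is the identity. [folklore] -/
theorem map_mulLeft_one (a : GrassmannAlgebra R Γ) :
    ExteriorAlgebra.map (LinearMap.mulLeft R (1 : Γ → R)) a = a := by
  rw [show LinearMap.mulLeft R (1 : Γ → R) = LinearMap.id from LinearMap.ext fun v => one_mul v,
    ExteriorAlgebra.map_id, AlgHom.id_apply]

/-- A scaling by units (`d * c = 1`) is undone by the reciprocal scaling. [folklore] -/
theorem map_mulLeft_map_mulLeft_of_mul_eq_one {c d : Γ → R} (h : d * c = 1) (a : GrassmannAlgebra R Γ) :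
    ExteriorAlgebra.map (LinearMap.mulLeft R d) (ExteriorAlgebra.map (LinearMap.mulLeft R c) a) = a := by
  rw [map_mulLeft_map_mulLeft, h, map_mulLeft_one]

/-- A scaling by units is injective. [folklore] -/
theorem map_mulLeft_injective {c d : Γ → R} (h : d * c = 1) :
    Function.Injective (ExteriorAlgebra.map (LinearMap.mulLeft R c) : GrassmannAlgebra R Γ → GrassmannAlgebra R Γ) :=
  Function.LeftInverse.injective (map_mulLeft_map_mulLeft_of_mul_eq_one R h)

/-- **Derivatives are covariant**: `∂_Y (S_c a) = c(Y) · S_c (∂_Y a)`. [folklore] -/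
theorem grassmannDeriv_map_mulLeft (c : Γ → R) (Y : Γ) (a : GrassmannAlgebra R Γ) :
    grassmannDeriv R Y (ExteriorAlgebra.map (LinearMap.mulLeft R c) a) =
      c Y • ExteriorAlgebra.map (LinearMap.mulLeft R c) (grassmannDeriv R Y a) := by
  induction a using CliffordAlgebra.left_induction with
  | algebraMap r => rw [AlgHom.commutes, grassmannDeriv_algebraMap, map_zero, smul_zero]
  | add x y hx hy => rw [map_add, map_add, hx, hy, map_add, map_add, smul_add]
  | ι_mul x v hx =>
    rw [map_mul, ExteriorAlgebra.map_apply_ι, grassmannDeriv_ι_mul, hx, grassmannDeriv_ι_mul, map_sub,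
      map_smul, map_mul, ExteriorAlgebra.map_apply_ι, LinearMap.mulLeft_apply, Pi.mul_apply, smul_sub,
      mul_smul, mul_smul_comm]

/-- **Iterated derivatives are covariant**: `∂_{X_{m-1}}⋯∂_{X_0} (S_c a) = (∏ᵢ c(Xᵢ)) · S_c (∂_{X_{m-1}}⋯∂_{X_0} a)`.
[folklore] -/
theorem iterDeriv_map_mulLeft (c : Γ → R) {m : ℕ} (X : Fin m → Γ) (a : GrassmannAlgebra R Γ) :
    iterDeriv R X (ExteriorAlgebra.map (LinearMap.mulLeft R c) a) =
      (∏ i, c (X i)) • ExteriorAlgebra.map (LinearMap.mulLeft R c) (iterDeriv R X a) := by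
  induction m generalizing a with
  | zero => simp [iterDeriv]
  | succ m ih =>
    rw [iterDeriv_succ_apply, iterDeriv_succ_apply R X, grassmannDeriv_map_mulLeft, map_smul, ih,
      smul_smul, Fin.prod_univ_succ, mul_comm]

variable [Algebra ℚ R]

/-- **Kernels of a rescaled element**: `kernel (S_c F) m X = (∏ᵢ c(Xᵢ)) · kernel F m X`. [folklore] -/
theorem kernel_map_mulLeft (c : Γ → R) (F : GrassmannAlgebra R Γ) (m : ℕ) (X : Fin m → Γ) :
    kernel R (ExteriorAlgebra.map (LinearMap.mulLeft R c) F) m X = (∏ i, c (X i)) * kernel R F m X := by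
  rw [kernel, kernel, iterDeriv_map_mulLeft, map_smul, constPart_map, smul_eq_mul]
  ring

omit [Algebra ℚ R] in
/-- A scaling by units preserves nilpotency classes (it is injective). [folklore] -/
theorem nilpotencyClass_map_mulLeft {c d : Γ → R} (h : d * c = 1) (a : GrassmannAlgebra R Γ) :
    nilpotencyClass (ExteriorAlgebra.map (LinearMap.mulLeft R c) a) = nilpotencyClass a := by
  unfold nilpotencyClass
  congr 1
  ext k
  simp only [Set.mem_setOf_eq, ← map_pow]
  exact map_eq_zero_iff _ (map_mulLeft_injective R h)

/-- A scaling by units commutes with the exponential. [folklore] -/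
theorem map_mulLeft_grassmannExp {c d : Γ → R} (h : d * c = 1) (a : GrassmannAlgebra R Γ) :
    ExteriorAlgebra.map (LinearMap.mulLeft R c) (grassmannExp a) =
      grassmannExp (ExteriorAlgebra.map (LinearMap.mulLeft R c) a) := by
  rw [grassmannExp, grassmannExp, IsNilpotent.exp, IsNilpotent.exp, map_sum, nilpotencyClass_map_mulLeft R h]
  simp only [map_rat_smul, map_pow]

/-- A scaling by units commutes with the logarithm. [folklore] -/
theorem map_mulLeft_grassmannLog1p {c d : Γ → R} (h : d * c = 1) (x : GrassmannAlgebra R Γ) :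
    ExteriorAlgebra.map (LinearMap.mulLeft R c) (grassmannLog1p R x) =
      grassmannLog1p R (ExteriorAlgebra.map (LinearMap.mulLeft R c) x) := by
  rw [grassmannLog1p, grassmannLog1p, map_sum, nilpotencyClass_map_mulLeft R h]
  simp only [map_rat_smul, map_pow]

variable [Fintype Γ]

/-- **The fermionic Laplacian is covariant**: `Δ_C (S_c a) = S_c (Δ_{c ⊗ c · C} a)` with the entrywise rescaled
covariance `(X, Y) ↦ c(X) c(Y) C(X, Y)`. [folklore] -/
theorem grassmannLaplacian_map_mulLeft (c : Γ → R) (C : Matrix Γ Γ R) (a : GrassmannAlgebra R Γ) :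
    grassmannLaplacian R C (ExteriorAlgebra.map (LinearMap.mulLeft R c) a) =
      ExteriorAlgebra.map (LinearMap.mulLeft R c)
        (grassmannLaplacian R (Matrix.of fun X Y => c X * c Y * C X Y) a) := by
  rw [grassmannLaplacian_apply, grassmannLaplacian_apply, map_smul, map_sum]
  congr 1
  refine Finset.sum_congr rfl fun X _ => ?_
  rw [map_sum]
  refine Finset.sum_congr rfl fun Y _ => ?_
  rw [map_smul, Matrix.of_apply, grassmannDeriv_map_mulLeft, map_smul, grassmannDeriv_map_mulLeft, smul_smul,
    smul_smul]
  congr 1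
  ring

/-- Powers of the Laplacian are covariant. [folklore] -/
theorem grassmannLaplacian_pow_map_mulLeft (c : Γ → R) (C : Matrix Γ Γ R) (k : ℕ) (a : GrassmannAlgebra R Γ) :
    (grassmannLaplacian R C ^ k) (ExteriorAlgebra.map (LinearMap.mulLeft R c) a) =
      ExteriorAlgebra.map (LinearMap.mulLeft R c)
        ((grassmannLaplacian R (Matrix.of fun X Y => c X * c Y * C X Y) ^ k) a) := by
  induction k generalizing a with
  | zero => simp
  | succ k ih =>
    rw [pow_succ, pow_succ, Module.End.mul_apply, Module.End.mul_apply, grassmannLaplacian_map_mulLeft, ih]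

/-- **The Gaussian convolution is covariant**: `μ_C ⋆ (S_c a) = S_c (μ_{c ⊗ c · C} ⋆ a)` (BGM 2006 §2.1: the
`U(1)` symmetry of `P(dψ)`). [folklore] -/
theorem gaussConv_map_mulLeft (c : Γ → R) (C : Matrix Γ Γ R) (a : GrassmannAlgebra R Γ) :
    gaussConv R C (ExteriorAlgebra.map (LinearMap.mulLeft R c) a) =
      ExteriorAlgebra.map (LinearMap.mulLeft R c) (gaussConv R (Matrix.of fun X Y => c X * c Y * C X Y) a) := by
  obtain ⟨k₁, hk₁⟩ := isNilpotent_grassmannLaplacian R C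
  obtain ⟨k₂, hk₂⟩ := isNilpotent_grassmannLaplacian R (Matrix.of fun X Y => c X * c Y * C X Y)
  have h₁ : grassmannLaplacian R C ^ (k₁ + k₂) = 0 := by rw [pow_add, hk₁, zero_mul]
  have h₂ : grassmannLaplacian R (Matrix.of fun X Y => c X * c Y * C X Y) ^ (k₁ + k₂) = 0 := by
    rw [pow_add, hk₂, mul_zero]
  rw [gaussConv, gaussConv, IsNilpotent.exp_eq_sum h₁, IsNilpotent.exp_eq_sum h₂]
  simp only [LinearMap.coe_sum, Finset.sum_apply, LinearMap.smul_apply, map_sum, map_rat_smul,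
    grassmannLaplacian_pow_map_mulLeft]

/-- The effective Boltzmann factor is covariant (scaling by units): `μ_C ⋆ e^{-S_c V} = S_c (μ_{c ⊗ c · C} ⋆ e^{-V})`.
[folklore] -/
theorem effBoltzmann_map_mulLeft {c d : Γ → R} (h : d * c = 1) (C : Matrix Γ Γ R) (V : GrassmannAlgebra R Γ) :
    effBoltzmann R C (ExteriorAlgebra.map (LinearMap.mulLeft R c) V) =
      ExteriorAlgebra.map (LinearMap.mulLeft R c) (effBoltzmann R (Matrix.of fun X Y => c X * c Y * C X Y) V) := by
  rw [effBoltzmann, effBoltzmann, ← map_neg, ← map_mulLeft_grassmannExp R h, gaussConv_map_mulLeft]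

/-- The normalised partition function is invariant (scaling by units):
`∫ dμ_C e^{-S_c V} = ∫ dμ_{c ⊗ c · C} e^{-V}`. [folklore] -/
theorem effPartitionFn_map_mulLeft {c d : Γ → R} (h : d * c = 1) (C : Matrix Γ Γ R) (V : GrassmannAlgebra R Γ) :
    effPartitionFn R C (ExteriorAlgebra.map (LinearMap.mulLeft R c) V) =
      effPartitionFn R (Matrix.of fun X Y => c X * c Y * C X Y) V := by
  rw [effPartitionFn, effBoltzmann_map_mulLeft R h, constPart_map, effPartitionFn]

/-- **The Wilsonian effective action is covariant under charge scalings of the fields** (scaling by units):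
`effAction C (S_c V) = S_c (effAction (c ⊗ c · C) V)` — the `U(1)` covariance of the Gaussian integration passes
to the effective action (BGM 2006 §2.1). [folklore] -/
theorem effAction_map_mulLeft {c d : Γ → R} (h : d * c = 1) (C : Matrix Γ Γ R) (V : GrassmannAlgebra R Γ) :
    effAction R C (ExteriorAlgebra.map (LinearMap.mulLeft R c) V) =
      ExteriorAlgebra.map (LinearMap.mulLeft R c) (effAction R (Matrix.of fun X Y => c X * c Y * C X Y) V) := by
  rw [effAction, effAction, effPartitionFn_map_mulLeft R h, effBoltzmann_map_mulLeft R h, map_neg,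
    map_mulLeft_grassmannLog1p R h, map_sub, map_one, map_smul]

/-! ### Symmetries: a charge scaling preserving covariance and interaction -/

/-- **A charge symmetry of covariance and interaction is a symmetry of the effective action**: for a scaling
by units with `c(X) c(Y) C(X, Y) = C(X, Y)` (the covariance pairs only labels of reciprocal weights) and
`S_c V = V`, `S_c (effAction C V) = effAction C V` (BGM 2006 §2.1, symmetry (2)). [folklore] -/
theorem map_mulLeft_effAction_of_invariant {c d : Γ → R} (h : d * c = 1) {C : Matrix Γ Γ R}
    (hC : ∀ X Y, c X * c Y * C X Y = C X Y) {V : GrassmannAlgebra R Γ}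
    (hV : ExteriorAlgebra.map (LinearMap.mulLeft R c) V = V) :
    ExteriorAlgebra.map (LinearMap.mulLeft R c) (effAction R C V) = effAction R C V := by
  have hC' : (Matrix.of fun X Y => c X * c Y * C X Y) = C := Matrix.ext fun X Y => hC X Y
  have h' := effAction_map_mulLeft R h C V
  rwa [hV, hC', eq_comm] at h'

/-- A charge symmetry of the covariance leaves the normalised partition function of every (rescaled) interaction
unchanged: `∫ dμ_C e^{-S_c V} = ∫ dμ_C e^{-V}`. [folklore] -/
theorem effPartitionFn_of_chargeInvariant {c d : Γ → R} (h : d * c = 1) {C : Matrix Γ Γ R}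
    (hC : ∀ X Y, c X * c Y * C X Y = C X Y) (V : GrassmannAlgebra R Γ) :
    effPartitionFn R C (ExteriorAlgebra.map (LinearMap.mulLeft R c) V) = effPartitionFn R C V := by
  have hC' : (Matrix.of fun X Y => c X * c Y * C X Y) = C := Matrix.ext fun X Y => hC X Y
  rw [effPartitionFn_map_mulLeft R h, hC']

omit [Fintype Γ] in
/-- **Kernels of an invariant element carry its charge**: if `S_c F = F` then
`(∏ᵢ c(Xᵢ)) · kernel F m X = kernel F m X` for every degree `m` and label string `X`. [folklore] -/
theorem prod_mul_kernel_of_invariant (c : Γ → R) {F : GrassmannAlgebra R Γ}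
    (hF : ExteriorAlgebra.map (LinearMap.mulLeft R c) F = F) (m : ℕ) (X : Fin m → Γ) :
    (∏ i, c (X i)) * kernel R F m X = kernel R F m X := by
  conv_rhs => rw [← hF]
  rw [kernel_map_mulLeft]

omit [Fintype Γ] in
/-- **The `U(1)` selection rule for kernels**: over a ring without zero divisors, if `S_c F = F` then the kernel of
`F` vanishes on every label string whose total weight `∏ᵢ c(Xᵢ)` is not `1` (for `c(ψ^±) = 2^{±1}`: unequal numbers
of `ψ⁺` and `ψ⁻` legs). [folklore] -/
theorem kernel_eq_zero_of_invariant [NoZeroDivisors R] (c : Γ → R) {F : GrassmannAlgebra R Γ}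
    (hF : ExteriorAlgebra.map (LinearMap.mulLeft R c) F = F) {m : ℕ} {X : Fin m → Γ}
    (hX : ∏ i, c (X i) ≠ 1) : kernel R F m X = 0 := by
  have h := prod_mul_kernel_of_invariant R c hF m X
  have h' : (∏ i, c (X i) - 1) * kernel R F m X = 0 := by rw [sub_mul, one_mul, h, sub_self]
  exact (mul_eq_zero.1 h').resolve_left (sub_ne_zero.2 hX)

end ChargeScaling

end Literature.MathematicalPhysics.QuantumLattice
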